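import Literature.NumberTheory.EllipticCurves.PNewBranchGaloisLattice
import Summits.BirchSwinnertonDyer.BirchSwinnertonDyer.Theorems.EisensteinPrimesBSDpOnCellCTelescopeCarrierAnDistOfCastella2020
import HarnessLib
/-!
# [telescope v16 → v17 recipe — ideator bsd-idea-12 g42, 2026-08-30] THE ANALYTIC PACKAGE WITH (dist), (wt), (rat) AND THE GALOIS LATTICE (G),
# from the sibling named fact T-An-2ᵍ `hida1986_castella2020_exists_galoisLattice_on_pNewBranchChart` — `carrierAnDistRatGal_of_galoisLattice`
# Crux 4 `BSDpOnCellC` (stmt-BirchSwinnertonDyer-19034), line «telescope» (`--supports`, helper; closes nothing registered)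

WHAT: the conclusion is the `hAn⁺` of telescope v16 (`stub_analyticBridgeRational`: LEAD g4's `carrierAnDist_of_castella2020` conclusion
with (wt) `∃ M, ∀ k, p^M · x_k = k_k − 2` and (rat) `∀ k, ℤ_p ↠ 𝒪_{ι_k}` appended) with ONE MORE conjunct for the SAME `(x, D)`:
(G) `∃ ρ, IsBranchGaloisLattice W p x D ρ` — a continuous framed `ρ : Γ_ℚ →ₜ* GL₂(ℤ_p⟦X⟧)` (product topology) unramified off `N`, with
`X = 0` fibre rationally conjugate to `T_pE` and member fibres conjugate to the members' self-dual data, all members `ℚ_p`-rational.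
So a successor reshape (v17) can thread (G) through the prefix package exactly as v16 threads (wt)/(rat): the bridge stub fed by THIS theorem
from the name `hida1986_castella2020_exists_galoisLattice_on_pNewBranchChart` (cite stub), and the lattice leaf N1♭⁺ — once its hypothesis
package ends with (G) — assembled from tree theorems (x2-p2 g23 `branchLattice_conclusion_of_framed_rat` ∘ g41 H1 ∘ g23 #10 ∘ ADAPTER-T ∘ g23 #9).

PROOF = LEAD g4's `carrierAnDist_of_castella2020` argument run on the ᵍ-package: `2 < p` and `Mult` from `CellC`; `j := toUnr p`; (an∞)/(an_k)
with `e := 0` by period rigidity / the ideal equality; (dist) by `TelescopeChartDistinctFibres.chart_infinite_range`; (wt) = clause 4 of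
`IsPNewBranchAnalyticChart`; (rat) = clause (G-rat) of `IsBranchGaloisLattice`; (G) verbatim.

HONEST FRAMING: a by-name bridge from a HYPOTHESIS-SHAPED named fact; it proves no stub unconditionally, no crux, no summit statement;
BSD is proved for no curve by this file. THEOREMS ONLY (no definition, no instance, no named fact, no `sorry`).
-/

set_option autoImplicit false
set_option linter.dupNamespace false

noncomputable section

open scoped Classical MatrixGroups ModularForm

open CongruenceSubgroup WeierstrassCurve NumberField IsDedekindDomain Field PowerSeries
  Literature.NumberTheory.EllipticCurves Literature.NumberTheory.EllipticCurves.GreenbergSelmer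
  Literature.NumberTheory.EllipticCurves.ModularForms Literature.NumberTheory.QuadraticFields
  Literature.NumberTheory.EllipticCurves.Rank1Residual
  Literature.NumberTheory.EllipticCurves.Rank1Residual.Typed
  Literature.NumberTheory.GaloisRepresentations Literature.NumberTheory.GaloisCohomology
  Summit.BirchSwinnertonDyer.Rank1Residual.X11b.AcSelmer
  Summit.BirchSwinnertonDyer.Rank1Residual.X11b.Halves
  Summit.BirchSwinnertonDyer.Rank1Residual.X11b
  Summit.BirchSwinnertonDyer.Rank1Residual Summit.BirchSwinnertonDyer.Rank1Residual.X1
  Summit.BirchSwinnertonDyer.Rank1Residual.X2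
open Literature.NumberTheory.EllipticCurves.BigGaloisRep
open Literature.NumberTheory.EllipticCurves.Castella2018

namespace Summit.BirchSwinnertonDyer.BirchSwinnertonDyer.Theorems.TelescopeCarrierAnDistRatGalOfGaloisLattice

open Summit.BirchSwinnertonDyer.BirchSwinnertonDyer.Theorems
/-- **The analytic package of the telescope WITH (dist), (wt), (rat) AND the Galois lattice (G) on the SAME chart** — the `hAn⁺` text of
telescope v16's `stub_analyticBridgeRational` (token for token) followed by `∃ ρ, IsBranchGaloisLattice W p x D ρ`, from the sibling named fact
`hida1986_castella2020_exists_galoisLattice_on_pNewBranchChart` (T-An-2ᵍ). Exponents `e := 0` in (an∞) and (an_k) as in the g2/g4 bridges.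
[cite: Castella2020JIMJ, Def. 2.10, Thm. 2.11, Rem. 2.12 (J. Inst. Math. Jussieu 19; arXiv:1410.6591v3 Def. 1.3 / Thm. 1.4)]
[cite: Hida1986, Thm. I, Cor. 1.4, Cor. 1.6, Thm. 2.1 (2.2b) (2.2c) (Invent. Math. 85)] [cite: Howard2007BigHeegner, Def. 2.1.3]
[cite: Venerucci2016, §2.4 (arXiv:1407.1913)] [cite: GreenbergStevens1993, §2] -/
theorem carrierAnDistRatGal_of_galoisLattice (h : hida1986_castella2020_exists_galoisLattice_on_pNewBranchChart) :
    ∀ (W : WeierstrassCurve ℚ) [W.IsElliptic] [W.IsGloballyMinimal] (p : ℕ) [Fact p.Prime],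
    ∀ (N : ℕ) [NeZero N] (K : Type) [Field K] [NumberField K] (Dt : ModularParametrizationData W N)
      (H : HeegnerDatum N (NumberField.discr K)) (ιK : K →+* ℂ) (P : (W.baseChange K).toAffine.Point),
      CellC W p → W.conductorNorm ℤ = N →
      IsImaginaryQuadratic K → NumberField.discr K < -4 → SatisfiesHeegnerHypothesis N K →
      (W.quadraticTwist (NumberField.discr K : ℚ)).entireLFunction 1 ≠ 0 →
      WeierstrassCurve.Affine.Point.map ιK.toRatAlgHom P = heegnerPointComplex Dt H →
      ¬ (p : ℤ) ∣ Dt.c → ¬ IsOfFinAddOrder P →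
      Odd (NumberField.discr K) →
      ∀ (κ : ZpExtension K p), κ.IsAnticyclotomic →
        ∀ (γ : Field.absoluteGaloisGroup K) [Fact (κ.IsTopGenerator γ)]
          (𝔭 : HeightOneSpectrum (𝓞 K)), ((p : ℕ) : 𝓞 K) ∈ 𝔭.asIdeal →
          𝔭.asIdeal.ramificationIdx (𝓞 ℚ) = 1 → 𝔭.asIdeal.inertiaDeg (𝓞 ℚ) = 1 →
          ∀ (𝔭bar : HeightOneSpectrum (𝓞 K)), ((p : ℕ) : 𝓞 K) ∈ 𝔭bar.asIdeal → 𝔭bar ≠ 𝔭 →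
            ((Ideal.span {(p : ℤ)}).primesOver (𝓞 K)).ncard = 2 →
          ∀ (f : CuspForm (CongruenceSubgroup.Gamma0 N) 2), IsNewformOf W f →
            ∀ (ι' : PadicAlgCl p ≃+* ℂ),
              (∀ (w : InfinitePlace K) (k : 𝓞 K),
                k ∈ 𝔭.asIdeal ↔ ‖ι'.symm (w.embedding (k : K))‖ < 1) →
              ∀ (ΩK : ℂ) (Ωp : ℂ_[p]) (Q : PowerSeries 𝓞_ℂ_[p]), ΩK ≠ 0 → ‖Ωp‖ = 1 →
                R1.IsBDPLFunctionInt p ι' 𝔭 κ γ f ΩK Ωp Q →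
      ∃ (L : PowerSeries (PowerSeries (unrIntegers p))) (x : ℕ → ℤ_[p]) (D : ℕ → Skinner2016.HidaCongruentForm W p 1),
        (∀ k, ‖x k‖ < 1) ∧ Filter.Tendsto x Filter.atTop (nhds 0) ∧ (Set.range x).Infinite ∧
        (∃ e : ℕ, PowerSeries.C ((p : 𝓞_ℂ_[p]) ^ e) * Q ∈
          Ideal.span {PowerSeries.map (R1.unrToCpInt p) (PowerSeries.map (PowerSeries.constantCoeff (R := unrIntegers p)) L)}) ∧
        (∀ k : ℕ, (∀ y : coeffField (D k).g, ι' ((D k).ι y) = (y : ℂ)) ∧ 2 * ((p : ℤ) - 1) ∣ (D k).k - 2 ∧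
          ∃ (ΩKg : ℂ) (Ωpg : ℂ_[p]) (Lg : UnrSeries p), ΩKg ≠ 0 ∧ ‖Ωpg‖ = 1 ∧
            IsBDPLFunctionWt ι' 𝔭 κ γ (D k).g ΩKg Ωpg Lg ∧
          ∃ Ψ : UnrSeries p,
            (∃ U : PowerSeries (PowerSeries (unrIntegers p)),
              PowerSeries.map (PowerSeries.C (R := unrIntegers p)) Ψ =
                L + PowerSeries.C (PowerSeries.X - PowerSeries.C (toUnr p (x k))) * U) ∧
            (∃ e : ℕ, PowerSeries.C ((p : 𝓞_ℂ_[p]) ^ e) * PowerSeries.map (R1.unrToCpInt p) Ψ ∈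
              Ideal.span {PowerSeries.map (R1.unrToCpInt p) Lg})) ∧
        (∃ A : ℕ → UnrSeries p, ∀ ℓ : ℕ, ℓ.Prime → ¬ ℓ ∣ N →
          (∃ U : UnrSeries p, A ℓ = PowerSeries.C (toUnr p ((W.frobeniusTrace ℓ : ℤ) : ℤ_[p])) + PowerSeries.X * U) ∧
          ∀ k : ℕ, ∃ (c : unrIntegers p) (U : UnrSeries p),
            A ℓ = PowerSeries.C c + (PowerSeries.X - PowerSeries.C (toUnr p (x k))) * U ∧
            ((c : ℂ_[p]) = algebraMap (PadicAlgCl p) ℂ_[p]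
              ((D k).ι ⟨(UpperHalfPlane.qExpansion 1 ⇑(D k).g).coeff ℓ, coeff_mem_coeffField (D k).g ℓ⟩))) ∧
        (∃ M : ℕ, ∀ k : ℕ, ((p : ℤ_[p]) ^ M) * x k = (((D k).k - 2 : ℤ) : ℤ_[p])) ∧
        (∀ k : ℕ, Function.Surjective (algebraMap ℤ_[p] (padicCoeffIntegers (D k).ι))) ∧
        (∃ ρ, IsBranchGaloisLattice W p x D ρ) := by
  intro W _ _ p _ N _ K _ _ Dt H ιK P hC hN hK hdisc hH _hL1 _hP _hc _hPinf hodd κ hκ γ _ 𝔭 h𝔭 _hram _hdeg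
    𝔭bar _h𝔭bar _hne hsplit f hf ι' hι' ΩK Ωp Q hΩK hΩp hQ
  have hp2 : 2 < p := MemberInvariantsOfAnacongWt.two_lt_of_cellC hC
  have hmult := MemberInvariantsOfAnacongWt.mult_of_cellC hC
  subst hN
  obtain ⟨A, x, D, hchart, ⟨ΩK', Ωp', L, hΩK', ⟨L₂, hL₂, hspan⟩, hfib⟩, ρ, hG⟩ :=
    h ι' W K 𝔭 κ γ hf rfl hp2 hmult hK hodd hdisc hH hsplit h𝔭 hι' hκ (toUnr p) (coe_toUnr p)
  have hΩp'1 : ‖((Ωp' : unrIntegers p) : ℂ_[p])‖ = 1 := norm_coe_units_unrIntegers p Ωp'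
  have hΩp'0 : ((Ωp' : unrIntegers p) : ℂ_[p]) ≠ 0 := by
    intro h0; rw [h0, norm_zero] at hΩp'1; exact zero_ne_one hΩp'1
  have hΩp0 : Ωp ≠ 0 := by
    intro h0; rw [h0, norm_zero] at hΩp; exact zero_ne_one hΩp
  refine ⟨L, x, D, hchart.1, hchart.2.1, TelescopeChartDistinctFibres.chart_infinite_range hchart, ?_, fun k ↦ ⟨(hchart.2.2.1 k).1, (hchart.2.2.1 k).2, ?_⟩,
    ⟨A, hchart.2.2.2.1⟩, hchart.2.2.2.2, hG.2.2.2, ρ, hG⟩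
  · -- (an∞): e := 0, by cross-period rigidity of the weight-2 frames
    refine ⟨0, ?_⟩
    have hQ₂ : R1.IsBDPLFunctionInt p ι' 𝔭 κ γ f ΩK' ((Ωp' : unrIntegers p) : ℂ_[p])
        (PowerSeries.map (R1.unrToCpInt p) L₂) := R1.isBDPLFunctionInt_map hL₂
    have hrig : Ideal.span ({Q} : Set (PowerSeries 𝓞_ℂ_[p])) =
        Ideal.span {PowerSeries.map (R1.unrToCpInt p) L₂} :=
      R1.span_singleton_eq_of_isBDPLFunctionInt hp2.ne' hK hκ Fact.out hΩK' hΩK hΩp'0 hΩp0 hQ₂ hQ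
    have hmap : Ideal.span {PowerSeries.map (R1.unrToCpInt p)
          (PowerSeries.map (PowerSeries.constantCoeff (R := unrIntegers p)) L)} =
        Ideal.span {PowerSeries.map (R1.unrToCpInt p) L₂} := by
      have := congrArg (Ideal.map (PowerSeries.map (R1.unrToCpInt p))) hspan
      simpa only [Ideal.map_span, Set.image_singleton] using this
    rw [pow_zero, map_one, one_mul, hmap, ← hrig]
    exact Ideal.mem_span_singleton_self Q
  · -- (an_k): the member frame at the SAME periods; e := 0 from the ideal equality
    obtain ⟨Ψ, Lg, hΨ, hLg, hspanΨ⟩ := hfib k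
    refine ⟨ΩK', ((Ωp' : unrIntegers p) : ℂ_[p]), Lg, hΩK', hΩp'1, hLg, Ψ, hΨ, 0, ?_⟩
    have hmem : Ψ ∈ Ideal.span {Lg} := hspanΨ ▸ Ideal.mem_span_singleton_self Ψ
    obtain ⟨a, ha⟩ := Ideal.mem_span_singleton'.mp hmem
    rw [pow_zero, map_one, one_mul, ← ha, map_mul]
    exact Ideal.mul_mem_left _ _ (Ideal.mem_span_singleton_self _)

end Summit.BirchSwinnertonDyer.BirchSwinnertonDyer.Theorems.TelescopeCarrierAnDistRatGalOfGaloisLattice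

end
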